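import Summits.QuantumFields.YangMills.Theorems.F4SubCurvatureDoorFibreDichotomySphereRadiality
import Summits.QuantumFields.YangMills.Theorems.F4SubCurvatureDoorFibreDichotomyShellLFAnalytic
import Mathlib
import HarnessLib

/-!
# LINE g21-B «fibre dichotomy» (⟨stmt-QuantumFields-23125⟩) — B4 helper: axis function of a shell measure and the two-point
# domination of an invariant patched kernel (stub plan steps H4, H5, H8)

Helper toward the registered stub B4 `stub_singleShellDichotomy` (stub plan `Lines/fibre_dichotomy_stubplans.md`).  For a shell measure `ν`
(`IsShellMeasure ν s`, verbatim copy of the tree) the AXIS FUNCTION `L_ν(t) = lfEval ν (t, 0⃗) = ∫ e^{−tE} dν` is non-negative and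
non-increasing on `(0, ∞)` (`lfEval_axis`, `axis_nonneg`, `axis_antitone`); a kernel `Kp` that is invariant under every `D₄`-isometry and
equals `lfEval ν` off the mirror is DOMINATED BY THE AXIS: `|Kp x| ≤ L_ν(‖x‖/√2)` for `x ≠ 0` (`kernel_le_axis`: the 24-cell covering
R-B4d `shortRootCovering_holds` + R-B4c `axisDomination_holds`, both landed), hence its sphere moments against a polynomial weight obey
`|∫ Y(α) Kp(rα) dσ| ≤ (∫ |Y| dσ) · L_ν(r/√2)` (`moment_le_axis`); and a shell measure of negative mass² is zero (`eq_zero_of_neg_mass`).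

Mathlib + tree only; no `sorry`; no new definitions.  HONEST LABEL: helper for a registered stub of an OPEN line; B4, B5, S1, S2, ⟨23125⟩,
⟨23035⟩, R2d and the Yang–Mills mass gap remain OPEN; no summit is proved by a line.
-/

noncomputable section

open MeasureTheory MeasureTheory.Measure Set Function Filter Topology Metric
open scoped BigOperators

namespace Summit.QuantumFields.YangMills.Theorems.F4SubCurvatureDoorHarmonicMomentODE

open Literature.Analysis.Calculus.MvPoly (toFun)
open Summit.QuantumFields.YangMills.Theorems.F4SubCurvatureDoorLaplaceFourierRegistered (E4 E3 timeSpace)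
open Summit.QuantumFields.YangMills.Theorems.F4SubCurvatureDoorFibreDichotomyAxis (spacePart lfEval IsD4Isometry axisDomination_holds
  shortRootCovering_holds)
open Summit.QuantumFields.YangMills.Theorems.F4SubCurvatureDoorShellLFAnalytic (massSq IsShellMeasure lfEval_timeSpace)

variable {ν : Measure (ℝ × E3)} {s : ℝ}

/-! ## The axis function `L_ν(t) = lfEval ν (t, 0⃗) = ∫ e^{−tE} dν` -/

/-- On the positive time axis the Laplace–Fourier evaluation is the Laplace transform of the energy distribution. -/
theorem lfEval_axis {t : ℝ} (ht : 0 < t) : lfEval ν (timeSpace t 0) = ∫ p : ℝ × E3, Real.exp (-(t * p.1)) ∂ν := by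
  rw [lfEval_timeSpace, abs_of_pos ht]
  refine integral_congr_ae (ae_of_all _ fun p => ?_)
  simp

/-- The axis function is non-negative. -/
theorem axis_nonneg {t : ℝ} (ht : 0 < t) : 0 ≤ lfEval ν (timeSpace t 0) := by
  rw [lfEval_axis ht]
  exact integral_nonneg fun p => (Real.exp_pos _).le

/-- The axis function of a shell measure is non-increasing on `(0, ∞)` (the energy is non-negative `ν`-a.e.). -/
theorem axis_antitone (h : IsShellMeasure ν s) {t₁ t₂ : ℝ} (h₁ : 0 < t₁) (h₁₂ : t₁ ≤ t₂) :
    lfEval ν (timeSpace t₂ 0) ≤ lfEval ν (timeSpace t₁ 0) := by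
  rw [lfEval_axis h₁, lfEval_axis (h₁.trans_le h₁₂)]
  refine integral_mono_ae (h.2.2 t₂ (h₁.trans_le h₁₂)) (h.2.2 t₁ h₁) ?_
  filter_upwards [h.ae_cone] with p hp
  exact Real.exp_le_exp.2 (by nlinarith [hp.1])

/-- A shell measure of negative squared mass vanishes (its support lies in the forward cone, where `E² − |q⃗|² ≥ 0`). -/
theorem eq_zero_of_neg_mass (h : IsShellMeasure ν s) (hs : s < 0) : ν = 0 := by
  rw [← measure_univ_eq_zero]
  refine measure_mono_null (fun p _ => ?_) (measure_union_null h.1 h.2.1)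
  by_cases hp : massSq p = s
  · left
    simp only [mem_setOf_eq]
    have hlt : p.1 ^ 2 < ‖p.2‖ ^ 2 := by
      have : p.1 ^ 2 - ‖p.2‖ ^ 2 < 0 := by rw [show p.1 ^ 2 - ‖p.2‖ ^ 2 = massSq p from rfl, hp]; exact hs
      linarith
    exact lt_of_le_of_lt (le_abs_self _) (abs_lt_of_sq_lt_sq hlt (norm_nonneg _))
  · right
    exact hp

/-- The Laplace–Fourier evaluation of the zero measure vanishes. -/
theorem lfEval_zero_measure (x : E4) : lfEval (0 : Measure (ℝ × E3)) x = 0 := by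
  simp [lfEval]

/-! ## Domination of an invariant patched kernel by the axis function -/

/-- **Two-point domination through the 24-cell**: an everywhere `D₄`-invariant kernel that equals `lfEval ν` off the mirror obeys
`|Kp x| ≤ L_ν(‖x‖/√2)` for `x ≠ 0` (R-B4d `ShortRootCovering` moves `x` to a point with `|time| ≥ ‖x‖/√2`, R-B4c `AxisDomination` and
monotonicity of the axis function do the rest). -/
theorem kernel_le_axis (h : IsShellMeasure ν s) {Kp : E4 → ℝ} (hinv : ∀ R : E4 ≃ₗᵢ[ℝ] E4, IsD4Isometry R → ∀ x : E4, Kp (R x) = Kp x)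
    (heq : ∀ x : E4, x 0 ≠ 0 → Kp x = lfEval ν x) {x : E4} (hx : x ≠ 0) :
    |Kp x| ≤ lfEval ν (timeSpace (‖x‖ / Real.sqrt 2) 0) := by
  obtain ⟨R, hR, hRx⟩ := shortRootCovering_holds x
  have hpos : 0 < ‖x‖ / Real.sqrt 2 := div_pos (norm_pos_iff.2 hx) (Real.sqrt_pos.2 (by norm_num))
  have h0 : (R x) 0 ≠ 0 := fun h0 => by
    rw [h0, abs_zero] at hRx
    exact not_lt.2 hRx hpos
  rw [← hinv R hR x, heq (R x) h0]
  exact (axisDomination_holds ν (R x) h0 h.2.2).trans (axis_antitone h hpos hRx)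

/-- Off the origin an invariant patched kernel is continuous if it is `C²` there (bookkeeping). -/
theorem continuousOn_of_contDiffAt {Kp : E4 → ℝ} (hC : ∀ x : E4, x ≠ 0 → ContDiffAt ℝ 2 Kp x) : ContinuousOn Kp {0}ᶜ :=
  fun x hx => (hC x hx).continuousAt.continuousWithinAt

/-- **Moment bound**: `|∫ Y(α) Kp(rα) dσ| ≤ (∫ |Y| dσ) · L_ν(r/√2)` for `r > 0`. -/
theorem moment_le_axis (h : IsShellMeasure ν s) {Kp : E4 → ℝ} (hinv : ∀ R : E4 ≃ₗᵢ[ℝ] E4, IsD4Isometry R → ∀ x : E4, Kp (R x) = Kp x)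
    (heq : ∀ x : E4, x 0 ≠ 0 → Kp x = lfEval ν x) (P : MvPolynomial (Fin 4) ℝ) {r : ℝ} (hr : 0 < r) :
    |∫ α, toFun P (α : E4) * Kp (r • (α : E4)) ∂(volume : Measure E4).toSphere| ≤
      (∫ α, |toFun P (α : E4)| ∂(volume : Measure E4).toSphere) * lfEval ν (timeSpace (r / Real.sqrt 2) 0) := by
  rw [← integral_mul_const, ← Real.norm_eq_abs]
  refine norm_integral_le_of_norm_le (integrable_sphere ((continuous_toFun_sphere P).abs.mul continuous_const))
    (ae_of_all _ fun α => ?_)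
  have hx0 : r • (α : E4) ≠ 0 := by
    rw [Ne, smul_eq_zero, not_or]
    exact ⟨hr.ne', ne_zero_of_mem_unit_sphere α⟩
  have hK := kernel_le_axis h hinv heq hx0
  rw [Literature.Analysis.FluidPDE.norm_smul_sphere hr.le α] at hK
  rw [Real.norm_eq_abs, abs_mul]
  exact mul_le_mul_of_nonneg_left hK (abs_nonneg _)

/-- **Boundedness of the moments on `[1, ∞)`** (the hypothesis of R-B4a `RadialODEDichotomy`). -/
theorem moment_bounded (h : IsShellMeasure ν s) {Kp : E4 → ℝ} (hinv : ∀ R : E4 ≃ₗᵢ[ℝ] E4, IsD4Isometry R → ∀ x : E4, Kp (R x) = Kp x)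
    (heq : ∀ x : E4, x 0 ≠ 0 → Kp x = lfEval ν x) (P : MvPolynomial (Fin 4) ℝ) :
    ∃ B : ℝ, ∀ r : ℝ, 1 ≤ r → |∫ α, toFun P (α : E4) * Kp (r • (α : E4)) ∂(volume : Measure E4).toSphere| ≤ B := by
  refine ⟨(∫ α, |toFun P (α : E4)| ∂(volume : Measure E4).toSphere) * lfEval ν (timeSpace (1 / Real.sqrt 2) 0), fun r hr => ?_⟩
  have hr0 : 0 < r := one_pos.trans_le hr
  refine (moment_le_axis h hinv heq P hr0).trans (mul_le_mul_of_nonneg_left ?_ (integral_nonneg fun α => abs_nonneg _))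
  have hs2 : 0 < Real.sqrt 2 := Real.sqrt_pos.2 (by norm_num)
  exact axis_antitone h (by positivity) (div_le_div_of_nonneg_right hr hs2.le)

end Summit.QuantumFields.YangMills.Theorems.F4SubCurvatureDoorHarmonicMomentODE

end
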